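import Summits.BirchSwinnertonDyer.BirchSwinnertonDyer.Theorems.KatoDescentPotSupersingularIntegralH1RankZero
import Literature.NumberTheory.EllipticCurves.Kato2004.MemberHullZetaInputs
import Literature.NumberTheory.EllipticCurves.Kato2004.IwasawaH1RankLeOneProofs
import HarnessLib

/-!
# Kato Thm. 12.5 (2) at the member is MODULE ALGEBRA on the pin: the clause `isTorsion_quotient`
# (`F ⧸ Λ·z_γ⁰` is `Λ`-torsion) of `Kato2004.MemberHull{,Zeta}Inputs` (item 19659 / wi-78945, crux M
# stmt-BirchSwinnertonDyer-19196 `ReducibleKatoMember`) follows from the hull fields, `z ≠ 0` and the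
# `Λ`-rank bound `rank_Λ 𝐇¹_Γ(T_pW) ≤ 1` — a tree theorem in rank `0` ((R0) + (R2))

Cell `bsd-potss`, seat `bsd-potss-rkm` generation 10; ROUTE-FREE; `--supports stmt-BirchSwinnertonDyer-19196`.

In the zeta-only package `Kato2004.MemberHullZetaInputs` (p519008) the field
`isTorsion_quotient : Module.IsTorsion Λ (F ⧸ Λ ∙ z)` transcribes Kato Thm. 12.5 (2) with 12.4 (2) («`F/Λz`
is torsion (rank one)»).  On the package's own data it is REDUNDANT: the hull `j : 𝐇¹_Γ ↪ F` has finite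
cokernel (`finite_coker`), so `rank_Λ F = rank_Λ 𝐇¹_Γ`; `rank_Λ 𝐇¹_Γ ≤ 1` is the tree theorem (R2)
`IwasawaH1Data.rank_le_one_of_rank_integralH1_le_one` (cell `bsd-cn100`, p514042) from the base-level bound
(R0) `rank_{ℤ_p} H¹(ℤ[1/p],T_pW) ≤ 1`, which holds whenever `W(ℚ)` and `Ш(W)[p^∞]` are finite
(`IntegralH1RankZero.rank_integralH1_layerZero_le_one`, rkm g9) — i.e. on every row of the member fact
(`L(W,1) ≠ 0`, `Ш(W)` finite, transported along the isogeny); and a finitely generated torsion-free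
`Λ`-module of rank `≤ 1` modulo a non-zero cyclic submodule is torsion (rank–nullity over the domain `Λ`).

* §1 module algebra over `Λ = ℤ_p⟦X⟧`: `isTorsion_of_finite` (a finite `Λ`-module is torsion),
  `rank_le_of_injective_of_finite_quotient` (finite cokernel ⇒ `rank F ≤ rank H`),
  `isTorsion_quotient_span_singleton_of_rank_le_one`.
* §2 on the pin: `isTorsion_hull_quotient_of_rank_integralH1_le_one` ((R0) displayed),
  `isTorsion_hull_quotient` ((R0) discharged: `W(ℚ)`, `Ш(W)[p^∞]` finite), and
  **`MemberHullZetaInputs.isTorsion_quotient_of_hull`** — the package's clause re-derived WITHOUT using it.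

CONSEQUENCE (planner / typer; nothing edited here): together with
`Theorems/KatoDescentPotSupersingularMemberIndexOfValue.lean` (`index_ne_zero` from the value, this seat) a
second re-type of the held input may drop `isTorsion_quotient` as well (no new hypothesis needed for it).
HONEST FRAMING: nothing is booked; the zeta fact stays a transcription of Kato's theorems at the member; BSD
is not advanced.

References: K. Kato, Astérisque 295 (2004), (12.2.1) (p. 220), Thm. 12.4 (2), Thm. 12.5 (2) (pp. 221–222),
13.14 (p. 234), Thm. 14.5 (1) (p. 236), 14.13 (p. 243) [Kato2004Asterisque]; C. Wuthrich, Doc. Math. 19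
(2014) Lemma 12 [Wuthrich2014]; N. Bourbaki, *AC* VII §4 no. 2 [BourbakiAC5to7]; tree
`Kato2004/IwasawaH1RankLeOneProofs` ((R2)), `Theorems/KatoDescentPotSupersingularIntegralH1RankZero` ((R0)).
-/

set_option autoImplicit false
set_option linter.dupNamespace false

noncomputable section

open scoped NumberField
open Field IsDedekindDomain Function
open Literature.NumberTheory.GaloisRepresentations
open Literature.NumberTheory.EllipticCurves Literature.NumberTheory.EllipticCurves.Kato2004
open Literature.NumberTheory.EllipticCurves.Kato2004.EulerSystemValues
open Literature.NumberTheory.EllipticCurves.IwasawaAlgebra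

namespace Summit.BirchSwinnertonDyer.BirchSwinnertonDyer.Theorems.MemberHullRankOne

/-! ## §1 Module algebra over `Λ` -/

section Algebra

universe u

variable (p : ℕ) [Fact p.Prime]

/-- A finite `Λ`-module is torsion: for `m ∈ M` the constants `c ↦ C(c)·m`, `c ∈ ℤ_p`, cannot all be distinct,
and `C(c₁ − c₂) ≠ 0` is a non-zero-divisor of the domain `Λ`. [folklore] -/
theorem isTorsion_of_finite {M : Type*} [AddCommGroup M] [Module (IwasawaAlgebra p) M] [Finite M] :
    Module.IsTorsion (IwasawaAlgebra p) M := by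
  intro m
  obtain ⟨c₁, c₂, hne, heq⟩ :=
    Finite.exists_ne_map_eq_of_infinite (fun c : ℤ_[p] => (PowerSeries.C c : IwasawaAlgebra p) • m)
  have hC : (PowerSeries.C (c₁ - c₂) : IwasawaAlgebra p) ≠ 0 := by
    intro h
    apply hne
    have h' : c₁ - c₂ = 0 := by
      have := congrArg PowerSeries.constantCoeff h
      simpa using this
    exact sub_eq_zero.mp h'
  refine ⟨⟨PowerSeries.C (c₁ - c₂), mem_nonZeroDivisors_of_ne_zero hC⟩, ?_⟩
  change (PowerSeries.C (c₁ - c₂) : IwasawaAlgebra p) • m = 0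
  rw [map_sub, sub_smul]
  exact sub_eq_zero.mpr heq

/-- Finite cokernel does not raise the rank: for an injective `Λ`-linear `j : H → F` with `F ⧸ j(H)` finite,
`rank_Λ F ≤ rank_Λ H` (rank–nullity over the domain `Λ`; the finite quotient is torsion of rank `0`).
[cite: BourbakiAC5to7, VII §4 no. 2] -/
theorem rank_le_of_injective_of_finite_quotient {H F : Type u} [AddCommGroup H]
    [Module (IwasawaAlgebra p) H] [AddCommGroup F] [Module (IwasawaAlgebra p) F]
    (j : H →ₗ[IwasawaAlgebra p] F) (hj : Injective j) (hfin : Finite (F ⧸ LinearMap.range j)) :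
    Module.rank (IwasawaAlgebra p) F ≤ Module.rank (IwasawaAlgebra p) H := by
  have h0 : Module.rank (IwasawaAlgebra p) (F ⧸ LinearMap.range j) = 0 :=
    rank_eq_zero_iff_isTorsion.mpr (isTorsion_of_finite p)
  have hsum := Submodule.rank_quotient_add_rank (LinearMap.range j)
  rw [h0, zero_add, ← (LinearEquiv.ofInjective j hj).rank_eq] at hsum
  exact hsum.symm.le

/-- **A finitely generated torsion-free `Λ`-module of rank `≤ 1` modulo a non-zero cyclic submodule is
torsion**: `finrank (F ⧸ Λz) + finrank (Λz) = finrank F ≤ 1` with `Λz ≅ Λ` of rank `1`.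
[cite: BourbakiAC5to7, VII §4 no. 2] -/
theorem isTorsion_quotient_span_singleton_of_rank_le_one {F : Type*} [AddCommGroup F]
    [Module (IwasawaAlgebra p) F] [Module.Finite (IwasawaAlgebra p) F]
    [NoZeroSMulDivisors (IwasawaAlgebra p) F]
    (hF : Module.rank (IwasawaAlgebra p) F ≤ 1) {z : F} (hz : z ≠ 0) :
    Module.IsTorsion (IwasawaAlgebra p) (F ⧸ (IwasawaAlgebra p) ∙ z) := by
  rw [← Module.finrank_eq_zero_iff_isTorsion]
  have hF' : Module.finrank (IwasawaAlgebra p) F ≤ 1 := Module.finrank_le_of_rank_le (by exact_mod_cast hF)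
  have h1 : Module.finrank (IwasawaAlgebra p) ((IwasawaAlgebra p) ∙ z) = 1 := by
    rw [← (LinearEquiv.toSpanNonzeroSingleton (IwasawaAlgebra p) F z hz).finrank_eq, Module.finrank_self]
  have hsum := Submodule.finrank_quotient_add_finrank ((IwasawaAlgebra p) ∙ z)
  omega

end Algebra

/-! ## §2 On the pin: Thm. 12.5 (2) at the member from (R0) + (R2) -/

section Pin

variable {W : WeierstrassCurve ℚ} [W.IsElliptic] {p : ℕ} [Fact p.Prime]
  [ContinuousSMul ℤ_[p] (W.tateModule p)] {κ : ZpExtension ℚ p} {γ : absoluteGaloisGroup ℚ}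

/-- **Thm. 12.5 (2) at the member from the hull, (R0) displayed.**  On a pin `I` (`κ` cyclotomic, `γ` a
topological generator) with `rank_{ℤ_p} H¹(ℤ[1/p],T_pW) ≤ 1`: for every finitely presented hull
`j : 𝐇¹_Γ ↪ F` (`F` finitely generated torsion free, finite cokernel) and every `z ≠ 0` in `F`, `F ⧸ Λz` is `Λ`-torsion — (R2)
`IwasawaH1Data.rank_le_one_of_rank_integralH1_le_one` and §1.
[cite: Kato2004Asterisque, Thm. 12.4 (2) and Thm. 12.5 (2) (pp. 221–222), 13.14 (p. 234)] -/
theorem isTorsion_hull_quotient_of_rank_integralH1_le_one (hκ : κ.IsCyclotomic) (hγ : κ.IsTopGenerator γ)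
    (I : IwasawaH1Data W p κ γ)
    (hrank : Module.rank ℤ_[p] (integralH1 (tateRep W p) p (κ.layerSubgroup 0)) ≤ 1)
    {F : Type} [AddCommGroup F] [Module (IwasawaAlgebra p) F] [Module.Finite (IwasawaAlgebra p) F]
    [NoZeroSMulDivisors (IwasawaAlgebra p) F]
    (j : I.H →ₗ[IwasawaAlgebra p] F) (hj : Injective j) (hfin : Finite (F ⧸ LinearMap.range j))
    {z : F} (hz : z ≠ 0) :
    Module.IsTorsion (IwasawaAlgebra p) (F ⧸ (IwasawaAlgebra p) ∙ z) :=
  isTorsion_quotient_span_singleton_of_rank_le_one p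
    ((rank_le_of_injective_of_finite_quotient p j hj hfin).trans
      (I.rank_le_one_of_rank_integralH1_le_one hκ hγ hrank)) hz

/-- **Thm. 12.5 (2) at the member from the hull, (R0) discharged** (`W(ℚ)` and `Ш(W)[p^∞]` finite:
`IntegralH1RankZero.rank_integralH1_layerZero_le_one`). [cite: Kato2004Asterisque, Thm. 12.5 (2) (p. 222), Thm. 14.5 (1) (p. 236), 14.13 (p. 243)] -/
theorem isTorsion_hull_quotient (hκ : κ.IsCyclotomic) (hγ : κ.IsTopGenerator γ)
    (I : IwasawaH1Data W p κ γ) [Finite W.toAffine.Point]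
    [Finite (AddCommGroup.primaryComponent W.sha p)]
    {F : Type} [AddCommGroup F] [Module (IwasawaAlgebra p) F] [Module.Finite (IwasawaAlgebra p) F]
    [NoZeroSMulDivisors (IwasawaAlgebra p) F]
    (j : I.H →ₗ[IwasawaAlgebra p] F) (hj : Injective j) (hfin : Finite (F ⧸ LinearMap.range j))
    {z : F} (hz : z ≠ 0) :
    Module.IsTorsion (IwasawaAlgebra p) (F ⧸ (IwasawaAlgebra p) ∙ z) :=
  isTorsion_hull_quotient_of_rank_integralH1_le_one hκ hγ I
    (IntegralH1RankZero.rank_integralH1_layerZero_le_one W p κ) j hj hfin hz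

/-- **The clause `isTorsion_quotient` of the zeta-only package re-derived WITHOUT using it**: for
`Z : MemberHullZetaInputs W p κ γ I 𝐲` (`κ` cyclotomic, `γ` a topological generator, `W(ℚ)` and
`Ш(W)[p^∞]` finite), `Z.F ⧸ Λ·Z.z` is `Λ`-torsion — from `Z.torsionFree_F`, `Z.j_injective`,
`Z.finite_coker`, `Z.z_ne_zero` and the tree's rank theorems only.
[cite: Kato2004Asterisque, Thm. 12.5 (2) (p. 222) and 13.14 (p. 234)] -/
theorem MemberHullZetaInputs.isTorsion_quotient_of_hull {I : IwasawaH1Data W p κ γ} {y : I.H}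
    (Z : MemberHullZetaInputs W p κ γ I y) (hκ : κ.IsCyclotomic) (hγ : κ.IsTopGenerator γ)
    [Finite W.toAffine.Point] [Finite (AddCommGroup.primaryComponent W.sha p)] :
    Module.IsTorsion (IwasawaAlgebra p) (Z.F ⧸ (IwasawaAlgebra p) ∙ Z.z) :=
  haveI := Z.torsionFree_F
  haveI := Z.finite_F
  isTorsion_hull_quotient hκ hγ I Z.j Z.j_injective Z.finite_coker Z.z_ne_zero

end Pin

end Summit.BirchSwinnertonDyer.BirchSwinnertonDyer.Theorems.MemberHullRankOne

end
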